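import Mathlib
import Summits.ResolutionOfSingularities.ResolutionOfSingularities.Theorems.WeightedInvariantLocalWeightedDropWildPurePowerDescentNormal
import Summits.ResolutionOfSingularities.ResolutionOfSingularities.Theorems.WeightedInvariantLocalWeightedDropWildMonicDescentThree

/-!
# `WeightedInvariant.LocalWeightedDrop`, line `hasse-ridge-face-selection`: the DESCENT LIFT for general monic surface forms,
# FOURTH FORM — every successor handed to the datum in NORMAL FORM `x ↦ x, y ↦ x(t + y)`

Crux item stmt-ResolutionOfSingularities-8899 `LocalWeightedDrop` (route `ResolutionOfSingularities/WeightedInvariant`), engine of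
the door `HypersurfaceCentreConstruction` stmt-ResolutionOfSingularities-19897.  [OURS · L1 W4.3, chain w43, res-type-083 (S3ρ first
seat; item (C9) ASSEMBLY of S3ρD₃).  Tuple version of stub-1's `WildPurePower.purePower_won_of_descent₃`.  Not a statement of any
manuscript.]  `monic_won_of_descent₄` refines `monic_won_of_descent₂`: at an exceptional point `c = (c₀, c₁) ≠ 0` of the point
blow-up the datum is handed, at its choice of slot, the NORMAL FORM of the successor tuple — slot `0` (`c₀ ≠ 0`): `T` with
`x^{d-j} · T_j = A₁_j(x, x(t + y))`, `t = c₁/c₀` (`PlaneGerm.dirChart t`); slot `1` (`c₁ ≠ 0`): the same for the letter swap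
`A₁^{sw}`, `t = c₀/c₁`; the new exceptional letter is always `x = X 0` — and owes a smaller state for EVERY re-centring `φ'`
(`φ'(0) = 0`) making `T` a position; no order / width / singularity hypotheses are handed down (inside the lift they select the
exits).  Nothing is lost: the literal successor is `(c_{i₀}^{d-j} · T_j(c_{i₀} x, c_{i₀}⁻¹ y))_j` (`exists_normalForm`, from
`BlowupScaling.slice_zero_chart` / `WildPurePower.slice_one_chart_swap`) and RESCALINGS ARE FREE (`won_monic_scale_iff`).
`wildMonicSurfaceReductionWon_of_descent₄`: S3ρ `stub_wildMonicSurfaceReductionWon` VERBATIM from a terminal predicate with its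
winning theorem and a NORMALISED datum with the four exits of the third form (terminal / pure `p^e`-form / non-reduced / zero).
-/

set_option linter.dupNamespace false -- mandated namespace of this single-conjunct summit

namespace Summit.ResolutionOfSingularities.ResolutionOfSingularities.Theorems

open Literature.AlgebraicGeometry.Resolution
open Literature.AlgebraicGeometry.Resolution.CobordantGame

namespace WildMonic

open MvPowerSeries

variable {k : Type} [Field k]

/-- RESCALINGS ARE FREE for monic tuples: for `γ ≠ 0`, the monic form of `(γ^{d-j} · T_j(γx, γ⁻¹y))_j` is won iff that of
`T` is — the plane change `(γx, γ⁻¹y)`, then `y ↦ γ⁻¹ y` together with the unit `γ^{-d}` (tuple version of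
`WildPurePower.won_purePower_scale_iff`). -/
theorem won_monic_scale_iff {γ : k} (hγ : γ ≠ 0) (d : ℕ) (T : Fin d → MvPowerSeries (Fin 2) k) :
    CobordantGame.Won k (2 + 1) (X (Fin.last 2) ^ d + ∑ j : Fin d, rename (Fin.succAboveEmb (Fin.last 2))
        (C (γ ^ (d - (j : ℕ))) * subst (PlaneGerm.diagScale γ γ⁻¹) (T j)) * X (Fin.last 2) ^ (j : ℕ)) ↔
      CobordantGame.Won k (2 + 1) (X (Fin.last 2) ^ d +
        ∑ j : Fin d, rename (Fin.succAboveEmb (Fin.last 2)) (T j) * X (Fin.last 2) ^ (j : ℕ)) := by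
  -- the plane rescaling
  have h1 : CobordantGame.Won k (2 + 1) (X (Fin.last 2) ^ d + ∑ j : Fin d, rename (Fin.succAboveEmb (Fin.last 2))
        (C (γ ^ (d - (j : ℕ))) * subst (PlaneGerm.diagScale γ γ⁻¹) (T j)) * X (Fin.last 2) ^ (j : ℕ)) ↔
      CobordantGame.Won k (2 + 1) (X (Fin.last 2) ^ d + ∑ j : Fin d, rename (Fin.succAboveEmb (Fin.last 2))
        (C (γ ^ (d - (j : ℕ))) * T j) * X (Fin.last 2) ^ (j : ℕ)) := by
    have h := won_monic_substX_iff (PlaneGerm.diagScale γ γ⁻¹) (PlaneGerm.constantCoeff_diagScale γ γ⁻¹)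
      (by rw [WildPurePower.linMat_diagScale_det, mul_inv_cancel₀ hγ]; exact isUnit_one)
      (fun j : Fin d => C (γ ^ (d - (j : ℕ))) * T j)
    simp only [BlowupScaling.subst_diagScale_C_mul] at h
    exact h
  rw [h1]
  -- `y ↦ γ⁻¹ y` and the unit `γ^{-d}`
  set Ψ : Fin (2 + 1) → MvPowerSeries (Fin (2 + 1)) k :=
    fun j => if j = Fin.last 2 then C γ⁻¹ * X j else X j with hΨ
  have hΨlast : Ψ (Fin.last 2) = C γ⁻¹ * X (Fin.last 2) := by simp [hΨ]
  have hΨcast : ∀ i : Fin 2, Ψ (Fin.castSucc i) = X (Fin.castSucc i) := fun i => by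
    show (if Fin.castSucc i = Fin.last 2 then C γ⁻¹ * X (Fin.castSucc i) else X (Fin.castSucc i)) = X (Fin.castSucc i)
    rw [if_neg (Fin.castSucc_lt_last i).ne]
  have hΨ0 : ∀ j, constantCoeff (Ψ j) = 0 := fun j => by
    refine Fin.lastCases ?_ (fun i => ?_) j
    · rw [hΨlast, map_mul, constantCoeff_X, mul_zero]
    · rw [hΨcast, constantCoeff_X]
  have rename_C' : ∀ a : k, rename (Fin.succAboveEmb (Fin.last 2)) (C a : MvPowerSeries (Fin 2) k) =
      (C a : MvPowerSeries (Fin (2 + 1)) k) := fun a => by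
    rw [← monomial_zero_eq_C_apply, rename_monomial, Finsupp.mapDomain_zero, monomial_zero_eq_C_apply]
  have hΨs : HasSubst Ψ := hasSubst_of_constantCoeff_zero hΨ0
  have hΨdet : IsUnit (FormalCoordChange.linMat Ψ).det := by
    have hM : FormalCoordChange.linMat Ψ = Matrix.diagonal (fun j : Fin (2 + 1) => if j = Fin.last 2 then γ⁻¹ else 1) := by
      ext i j
      rw [FormalCoordChange.linMat, Matrix.of_apply, Matrix.diagonal_apply, hΨ]
      by_cases hi : i = Fin.last 2
      · simp only [hi, if_true, coeff_C_mul, coeff_X, Finsupp.single_eq_single_iff, one_ne_zero, and_true,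
          and_self, or_false]
        by_cases hj : Fin.last 2 = j
        · subst hj; simp
        · rw [if_neg (fun h => hj h.symm), if_neg hj, mul_zero]
      · simp only [if_neg hi, coeff_X, Finsupp.single_eq_single_iff, one_ne_zero, and_true, and_self, or_false]
        by_cases hj : i = j
        · subst hj; simp
        · rw [if_neg (fun h => hj h.symm), if_neg hj]
    rw [hM, Matrix.det_diagonal]
    exact isUnit_iff_ne_zero.mpr (Finset.prod_ne_zero_iff.mpr fun j _ => by
      split_ifs; exacts [inv_ne_zero hγ, one_ne_zero])
  have hren : ∀ F : MvPowerSeries (Fin 2) k,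
      subst Ψ (rename (Fin.succAboveEmb (Fin.last 2)) F) = rename (Fin.succAboveEmb (Fin.last 2)) F := fun F => by
    rw [subst_rename_eq _ Ψ hΨ0 F, rename_eq_subst]
    congr 1
    funext i
    have hi : (Fin.succAboveEmb (Fin.last 2)) i = Fin.castSucc i := by
      rw [Fin.coe_succAboveEmb, Fin.succAbove_last]
    rw [Function.comp_apply, hi, hΨcast]
  have hkey : subst Ψ (X (Fin.last 2) ^ d + ∑ j : Fin d, rename (Fin.succAboveEmb (Fin.last 2)) (T j) * X (Fin.last 2) ^ (j : ℕ)) =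
      C (γ⁻¹ ^ d) * (X (Fin.last 2) ^ d + ∑ j : Fin d, rename (Fin.succAboveEmb (Fin.last 2))
        (C (γ ^ (d - (j : ℕ))) * T j) * X (Fin.last 2) ^ (j : ℕ)) := by
    rw [← coe_substAlgHom hΨs, map_add, map_pow, map_sum, coe_substAlgHom, subst_X hΨs, hΨlast, mul_add, mul_pow,
      ← map_pow, Finset.mul_sum]
    congr 1
    refine Finset.sum_congr rfl fun j _ => ?_
    rw [← coe_substAlgHom hΨs, map_mul, map_pow, coe_substAlgHom, hren, subst_X hΨs, hΨlast, map_mul (rename _),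
      rename_C', mul_pow, ← map_pow]
    have hjd : (j : ℕ) ≤ d := j.2.le
    have hγj : (γ⁻¹ ^ d : k) * γ ^ (d - (j : ℕ)) = γ⁻¹ ^ (j : ℕ) := by
      calc (γ⁻¹ ^ d : k) * γ ^ (d - (j : ℕ)) = γ⁻¹ ^ (d - (j : ℕ) + (j : ℕ)) * γ ^ (d - (j : ℕ)) := by
            rw [Nat.sub_add_cancel hjd]
        _ = γ⁻¹ ^ (j : ℕ) * (γ⁻¹ * γ) ^ (d - (j : ℕ)) := by rw [pow_add, mul_pow]; ring
        _ = γ⁻¹ ^ (j : ℕ) := by rw [inv_mul_cancel₀ hγ, one_pow, mul_one]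
    calc rename (Fin.succAboveEmb (Fin.last 2)) (T j) * (C (γ⁻¹ ^ (j : ℕ)) * X (Fin.last 2) ^ (j : ℕ))
        = C (γ⁻¹ ^ d * γ ^ (d - (j : ℕ))) * rename (Fin.succAboveEmb (Fin.last 2)) (T j) * X (Fin.last 2) ^ (j : ℕ) := by
          rw [hγj]; ring
      _ = C (γ⁻¹ ^ d) * (C (γ ^ (d - (j : ℕ))) * rename (Fin.succAboveEmb (Fin.last 2)) (T j) * X (Fin.last 2) ^ (j : ℕ)) := by
          rw [map_mul]; ring
  rw [← won_subst_iff hΨ0 hΨdet (X (Fin.last 2) ^ d +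
    ∑ j : Fin d, rename (Fin.succAboveEmb (Fin.last 2)) (T j) * X (Fin.last 2) ^ (j : ℕ)), hkey]
  exact (won_unit_mul_iff (by rw [constantCoeff_C]; exact pow_ne_zero d (inv_ne_zero hγ)) _).symm

/-- THE NORMAL FORM OF THE SUCCESSOR TUPLE at a slot: if the slice `i₀` of the chart-image of each `A₁_j` is the rescaling
`(γx, γ⁻¹y)` of `A'_j(x, x(t + y))`, and `A₁_j ∘ chart(c) = s^{d-j+1} · Bv_j`, then there is a tuple `T'` with
`x^{d-j} · T'_j = A'_j(x, x(t+y))` and the literal successor is `(s · Bv_j)|_{slice i₀} = γ^{d-j} · T'_j(γx, γ⁻¹y)`. -/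
theorem exists_normalForm {d : ℕ} (c : Fin 2 → k) (A₁ A' : Fin d → MvPowerSeries (Fin 2) k)
    (Bv : Fin d → MvPowerSeries (Fin (2 + 1)) k)
    (hBv : ∀ j : Fin d, subst (CobordantChart.chart (fun _ : Fin 2 => 1) c) (A₁ j) = X 0 ^ (d - (j : ℕ) + 1) * Bv j)
    (i₀ : Fin 2) {γ : k} (t : k) (hγ : γ ≠ 0)
    (hsl : ∀ j : Fin d, TupleGame.slice i₀ (subst (CobordantChart.chart (fun _ : Fin 2 => 1) c) (A₁ j)) =
      subst (PlaneGerm.diagScale γ γ⁻¹) (subst (PlaneGerm.dirChart t) (A' j))) :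
    ∃ T' : Fin d → MvPowerSeries (Fin 2) k,
      (∀ j : Fin d, X 0 ^ (d - (j : ℕ)) * T' j = subst (PlaneGerm.dirChart t) (A' j)) ∧
      ∀ j : Fin d, TupleGame.slice i₀ (X 0 * Bv j) = C (γ ^ (d - (j : ℕ))) * subst (PlaneGerm.diagScale γ γ⁻¹) (T' j) := by
  have hTa : ∀ j : Fin d, X 0 ^ (d - (j : ℕ)) * TupleGame.slice i₀ (X 0 * Bv j) =
      subst (PlaneGerm.diagScale γ γ⁻¹) (subst (PlaneGerm.dirChart t) (A' j)) := fun j => by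
    rw [← hsl j, hBv j, MultiplicityLift.slice_X_zero_pow_mul, WildTerminal.slice_mul, WildTerminal.slice_X_zero]
    ring
  refine ⟨fun j => C (γ⁻¹ ^ (d - (j : ℕ))) * subst (PlaneGerm.diagScale γ⁻¹ γ⁻¹⁻¹) (TupleGame.slice i₀ (X 0 * Bv j)),
    fun j => ?_, fun j => ?_⟩
  · have h1 : subst (PlaneGerm.diagScale γ⁻¹ γ⁻¹⁻¹) (X 0 ^ (d - (j : ℕ)) * TupleGame.slice i₀ (X 0 * Bv j)) =
        subst (PlaneGerm.dirChart t) (A' j) := by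
      rw [hTa j, BlowupScaling.subst_diagScale_subst_diagScale, mul_inv_cancel₀ hγ, inv_inv, inv_mul_cancel₀ hγ,
        BlowupScaling.subst_diagScale_one]
    have hD := PlaneGerm.hasSubst_diagScale (k := k) γ⁻¹ γ⁻¹⁻¹
    rw [← h1, subst_mul hD, subst_pow hD, subst_X hD, PlaneGerm.diagScale_zero, mul_pow, ← map_pow]
    ring
  · rw [BlowupScaling.subst_diagScale_C_mul, inv_inv, BlowupScaling.subst_diagScale_subst_diagScale,
      inv_mul_cancel₀ hγ, mul_inv_cancel₀ hγ, BlowupScaling.subst_diagScale_one, ← mul_assoc, ← map_mul,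
      ← mul_pow, mul_inv_cancel₀ hγ, one_pow, map_one, one_mul]

/-- THE DESCENT LIFT FOR GENERAL MONIC SURFACE FORMS, NORMALISED (`d ≥ 1`, `k` algebraically closed of characteristic `p`).
As `monic_won_of_descent₂` (exit predicate `T` with its winning proof; zero-tuple exit), except for the point-blow-up clause of
the step property: at an exceptional point `c = (c₀, c₁) ≠ 0` the datum serves, at its choice, EITHER (if `c₀ ≠ 0`) the tuple
`T'` with `x^{d-j} · T'_j = A₁_j(x, x(c₁/c₀ + y))` (`PlaneGerm.dirChart`), OR (if `c₁ ≠ 0`) the tuple `T'` with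
`x^{d-j} · T'_j = A₁_j^{sw}(x, x(c₀/c₁ + y))`, `A₁^{sw}` the letter swap — in both cases the exceptional letter of the successor is
`x = X 0` — and owes a state of smaller measure for every re-centring `φ'` (`φ'(0) = 0`) making `T'` a position. -/
theorem monic_won_of_descent₄ (p : ℕ) (hp : p.Prime) (k : Type) [Field k] [CharP k p] [IsAlgClosed k] {d : ℕ} (hd : 0 < d)
    (hord : ∀ g : MvPowerSeries (Fin 3) k, CobordantGame.IsSingular k g → g.order < d → CobordantGame.Won k 3 g)
    (haxis : ∀ g : MvPowerSeries (Fin 3) k, CobordantGame.IsSingular k g → g.order = d →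
      (∃ c : Fin 3 → k, c ≠ 0 ∧ ∀ v : Fin 3 → k,
        CobordantChart.initEval (fun _ : Fin 3 => 1) (v + c) d g = CobordantChart.initEval (fun _ : Fin 3 => 1) v d g) →
      (∀ c₁ c₂ : Fin 3 → k,
        (∀ v : Fin 3 → k, CobordantChart.initEval (fun _ : Fin 3 => 1) (v + c₁) d g =
          CobordantChart.initEval (fun _ : Fin 3 => 1) v d g) →
        (∀ v : Fin 3 → k, CobordantChart.initEval (fun _ : Fin 3 => 1) (v + c₂) d g =
          CobordantChart.initEval (fun _ : Fin 3 => 1) v d g) →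
        ∃ α β : k, (α ≠ 0 ∨ β ≠ 0) ∧ α • c₁ + β • c₂ = 0) →
      CobordantGame.Won k 3 g)
    (T : (Fin d → MvPowerSeries (Fin 2) k) → Prop)
    (hT : ∀ A : Fin d → MvPowerSeries (Fin 2) k, (∀ j : Fin d, ((d - (j : ℕ) : ℕ) : ℕ∞) < (A j).order) → T A →
      CobordantGame.Won k (2 + 1) ((X (Fin.last 2) : MvPowerSeries (Fin (2 + 1)) k) ^ d +
        ∑ j : Fin d, rename (Fin.succAboveEmb (Fin.last 2)) (A j) * X (Fin.last 2) ^ (j : ℕ)))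
    {S : Type*} (germ : S → Fin d → MvPowerSeries (Fin 2) k) (μ : S → Ordinal.{0})
    (hstep : ∀ s : S, (∀ j : Fin d, ((d - (j : ℕ) : ℕ) : ℕ∞) < (germ s j).order) →
      ∃ (θ : Fin 2 → MvPowerSeries (Fin 2) k) (φ : MvPowerSeries (Fin 2) k),
        (∀ i, constantCoeff (θ i) = 0) ∧ IsUnit (FormalCoordChange.linMat θ).det ∧ constantCoeff φ = 0 ∧
        (∀ j : Fin d, ((d - (j : ℕ) : ℕ) : ℕ∞) < (shift d (fun j => subst θ (germ s j)) φ j).order) ∧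
        (T (shift d (fun j => subst θ (germ s j)) φ) ∨
          (∀ j : Fin d, shift d (fun j => subst θ (germ s j)) φ j = 0) ∨
          ∀ (c : Fin 2 → k), (∃ i, c i ≠ 0) →
            (c 0 ≠ 0 ∧ ∀ T' : Fin d → MvPowerSeries (Fin 2) k,
              (∀ j : Fin d, X 0 ^ (d - (j : ℕ)) * T' j =
                subst (PlaneGerm.dirChart (c 1 / c 0)) (shift d (fun j => subst θ (germ s j)) φ j)) →
              ∀ φ' : MvPowerSeries (Fin 2) k, constantCoeff φ' = 0 →
              (∀ j : Fin d, ((d - (j : ℕ) : ℕ) : ℕ∞) < (shift d T' φ' j).order) →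
              ∃ s' : S, germ s' = shift d T' φ' ∧ μ s' < μ s) ∨
            (c 1 ≠ 0 ∧ ∀ T' : Fin d → MvPowerSeries (Fin 2) k,
              (∀ j : Fin d, X 0 ^ (d - (j : ℕ)) * T' j =
                subst (PlaneGerm.dirChart (c 0 / c 1))
                  (rename (Equiv.swap (0 : Fin 2) 1) (shift d (fun j => subst θ (germ s j)) φ j))) →
              ∀ φ' : MvPowerSeries (Fin 2) k, constantCoeff φ' = 0 →
              (∀ j : Fin d, ((d - (j : ℕ) : ℕ) : ℕ∞) < (shift d T' φ' j).order) →
              ∃ s' : S, germ s' = shift d T' φ' ∧ μ s' < μ s))) :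
    ∀ s : S, (∀ j : Fin d, ((d - (j : ℕ) : ℕ) : ℕ∞) < (germ s j).order) →
      CobordantGame.Won k (2 + 1) ((X (Fin.last 2) : MvPowerSeries (Fin (2 + 1)) k) ^ d +
        ∑ j : Fin d, rename (Fin.succAboveEmb (Fin.last 2)) (germ s j) * X (Fin.last 2) ^ (j : ℕ)) := by
  classical
  suffices key : ∀ (α : Ordinal.{0}) (s : S), μ s = α → (∀ j : Fin d, ((d - (j : ℕ) : ℕ) : ℕ∞) < (germ s j).order) →
      Won k (2 + 1) ((X (Fin.last 2) : MvPowerSeries (Fin (2 + 1)) k) ^ d +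
        ∑ j : Fin d, rename (Fin.succAboveEmb (Fin.last 2)) (germ s j) * X (Fin.last 2) ^ (j : ℕ)) from
    fun s hs => key _ s rfl hs
  intro α
  induction α using WellFoundedLT.induction with
  | ind α ih =>
  intro s hα hs
  obtain ⟨θ, φ, hθ0, hθdet, hφ0, hA₁, hbr⟩ := hstep s hs
  -- the free moves: plane change, then re-centring
  rw [← won_monic_substX_iff θ hθ0 hθdet, ← won_monic_recentre_iff φ hφ0]
  set A₁ : Fin d → MvPowerSeries (Fin 2) k := shift d (fun j => subst θ (germ s j)) φ with hA₁def
  rcases hbr with hTA | hzero | hpt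
  · exact hT A₁ hA₁ hTA
  · -- the `d`-fold plane `y^d`: one move, no singular successor
    have hP : (X (Fin.last 2) : MvPowerSeries (Fin (2 + 1)) k) ^ d +
        ∑ j : Fin d, rename (Fin.succAboveEmb (Fin.last 2)) (A₁ j) * X (Fin.last 2) ^ (j : ℕ) = X (Fin.last 2) ^ d := by
      rw [Finset.sum_eq_zero, add_zero]
      intro j _
      rw [hzero j, map_zero, zero_mul]
    rw [hP]
    exact WildPurePower.won_X_pow_last 2 d
  · -- the point blow-up, live slot chosen by the datum; every successor read in its normal form
    refine won_monic_of_pointBlowup_slot p hp k 2 d hd A₁ hA₁ fun c hc Bv hBv => ?_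
    -- the exit analysis on a normal form `T'` served by the datum
    have hplay : ∀ T' : Fin d → MvPowerSeries (Fin 2) k,
        (∀ φ' : MvPowerSeries (Fin 2) k, constantCoeff φ' = 0 →
          (∀ j : Fin d, ((d - (j : ℕ) : ℕ) : ℕ∞) < (shift d T' φ' j).order) →
          ∃ s' : S, germ s' = shift d T' φ' ∧ μ s' < μ s) →
        Won k (2 + 1) ((X (Fin.last 2) : MvPowerSeries (Fin (2 + 1)) k) ^ d +
          ∑ j : Fin d, rename (Fin.succAboveEmb (Fin.last 2)) (T' j) * X (Fin.last 2) ^ (j : ℕ)) := by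
      intro T' hsl
      set Sg : MvPowerSeries (Fin (2 + 1)) k := (X (Fin.last 2) : MvPowerSeries (Fin (2 + 1)) k) ^ d +
        ∑ j : Fin d, rename (Fin.succAboveEmb (Fin.last 2)) (T' j) * X (Fin.last 2) ^ (j : ℕ) with hSg
      by_cases hSs : CobordantGame.IsSingular k Sg
      swap
      · exact (wonBy_zero_of_not_isSingular (Nat.succ_pos 2) hSs).won
      by_cases hlt : Sg.order < (d : ℕ)
      · exact hord _ hSs hlt
      rw [not_lt] at hlt
      have hSo : Sg.order = d := le_antisymm (order_monicForm_le T') hlt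
      by_cases hwide : ∃ c₁ c₂ : Fin 3 → k, (∀ α β : k, α • c₁ + β • c₂ = 0 → α = 0 ∧ β = 0) ∧
          (∀ v : Fin 3 → k, CobordantChart.initEval (fun _ : Fin 3 => 1) (v + c₁) d Sg =
            CobordantChart.initEval (fun _ : Fin 3 => 1) v d Sg) ∧
          (∀ v : Fin 3 → k, CobordantChart.initEval (fun _ : Fin 3 => 1) (v + c₂) d Sg =
            CobordantChart.initEval (fun _ : Fin 3 => 1) v d Sg)
      · -- wide apex: re-centre linearly to a position, which is a smaller state
        obtain ⟨c₁, c₂, hind, h₁, h₂⟩ := hwide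
        obtain ⟨μ', hpos⟩ := exists_linShift_isPos_of_wide k hd T' hlt c₁ c₂ hind h₁ h₂
        have hφ'0 : constantCoeff (-(∑ i : Fin 2, C (μ' i) * X i) : MvPowerSeries (Fin 2) k) = 0 := by
          rw [map_neg, map_sum, Finset.sum_eq_zero, neg_zero]
          intro i _
          rw [map_mul, constantCoeff_X, mul_zero]
        obtain ⟨s', hs', hμ⟩ := hsl _ hφ'0 hpos
        rw [hSg, ← won_monic_recentre_iff (-(∑ i : Fin 2, C (μ' i) * X i)) hφ'0 T', ← hs']
        exact ih (μ s') (hα ▸ hμ) s' rfl (by rw [hs']; exact hpos)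
      · -- not wide: apex-free or axis
        exact WildPurePower.won_of_order_eq_of_not_wide p hp k hord haxis _ hSs hSo hwide
    rcases hpt c hc with ⟨hc0, hsl⟩ | ⟨hc1, hsl⟩
    · obtain ⟨T', hT', hrel⟩ := exists_normalForm c A₁ A₁ Bv hBv 0 (c 1 / c 0) hc0
        (fun j => WildPurePower.slice_zero_chart' hc0 (A₁ j))
      refine ⟨0, hc0, fun _ => ?_⟩
      simp only [hrel]
      rw [won_monic_scale_iff hc0]
      exact hplay T' (hsl T' hT')
    · obtain ⟨T', hT', hrel⟩ := exists_normalForm c A₁ (fun j => rename (Equiv.swap (0 : Fin 2) 1) (A₁ j)) Bv hBv 1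
        (c 0 / c 1) hc1 (fun j => WildPurePower.slice_one_chart_swap hc1 (A₁ j))
      refine ⟨1, hc1, fun _ => ?_⟩
      simp only [hrel]
      rw [won_monic_scale_iff hc1]
      exact hplay T' (hsl T' hT')

/-- S3ρ `stub_wildMonicSurfaceReductionWon` VERBATIM FROM THE PIECES, FOURTH FORM: a TERMINAL PREDICATE `Term` with its winning
theorem (S3ρT) and a NORMALISED DESCENT DATUM (S3ρD₄) covering every position, with the step property of `monic_won_of_descent₄`
relative to the exits «`Term`», «pure `p^e`-th power form», «NON-REDUCED factorisation `U · ∏ Qᵢ^{mᵢ}` with `ord ∏ Qᵢ < d`»,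
«zero tuple», and the slot-choosing point blow-up whose successors are served in the normal form `x ↦ x, y ↦ x(t + y)`. -/
theorem wildMonicSurfaceReductionWon_of_descent₄
    (Term : ∀ (k : Type) [Field k] (d : ℕ), (Fin d → MvPowerSeries (Fin 2) k) → Prop)
    (hterm : ∀ (p : ℕ), p.Prime → ∀ (k : Type) [Field k] [CharP k p] [IsAlgClosed k],
      ∀ (d : ℕ), p ∣ d → 2 < d →
      (∀ g : MvPowerSeries (Fin 3) k, CobordantGame.IsSingular k g → g.order < d →
        CobordantGame.Won k 3 g) →
      (∀ g : MvPowerSeries (Fin 3) k, CobordantGame.IsSingular k g → g.order = d →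
        (∃ c : Fin 3 → k, c ≠ 0 ∧ ∀ v : Fin 3 → k,
          CobordantChart.initEval (fun _ : Fin 3 => 1) (v + c) d g =
            CobordantChart.initEval (fun _ : Fin 3 => 1) v d g) →
        (∀ c₁ c₂ : Fin 3 → k,
          (∀ v : Fin 3 → k, CobordantChart.initEval (fun _ : Fin 3 => 1) (v + c₁) d g =
            CobordantChart.initEval (fun _ : Fin 3 => 1) v d g) →
          (∀ v : Fin 3 → k, CobordantChart.initEval (fun _ : Fin 3 => 1) (v + c₂) d g =
            CobordantChart.initEval (fun _ : Fin 3 => 1) v d g) →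
          ∃ α β : k, (α ≠ 0 ∨ β ≠ 0) ∧ α • c₁ + β • c₂ = 0) →
        CobordantGame.Won k 3 g) →
      ∀ A : Fin d → MvPowerSeries (Fin 2) k, (∀ j : Fin d, ((d - (j : ℕ) : ℕ) : ℕ∞) < (A j).order) → Term k d A →
        CobordantGame.Won k 3 (MvPowerSeries.X (Fin.last 2) ^ d +
          ∑ j : Fin d, MvPowerSeries.rename (Fin.succAboveEmb (Fin.last 2)) (A j) * MvPowerSeries.X (Fin.last 2) ^ (j : ℕ)))
    (hdesc : ∀ (p : ℕ), p.Prime → ∀ (k : Type) [Field k] [CharP k p] [IsAlgClosed k],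
      (∀ m : ℕ, m < 3 → ∀ g : MvPowerSeries (Fin m) k,
        CobordantGame.IsSingular k g → CobordantGame.Won k m g) →
      ∀ (d : ℕ), p ∣ d → 2 < d →
      (∀ g : MvPowerSeries (Fin 3) k, CobordantGame.IsSingular k g → g.order < d →
        CobordantGame.Won k 3 g) →
      (∀ g : MvPowerSeries (Fin 3) k, CobordantGame.IsSingular k g → g.order = d →
        (∃ c : Fin 3 → k, c ≠ 0 ∧ ∀ v : Fin 3 → k,
          CobordantChart.initEval (fun _ : Fin 3 => 1) (v + c) d g =
            CobordantChart.initEval (fun _ : Fin 3 => 1) v d g) →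
        (∀ c₁ c₂ : Fin 3 → k,
          (∀ v : Fin 3 → k, CobordantChart.initEval (fun _ : Fin 3 => 1) (v + c₁) d g =
            CobordantChart.initEval (fun _ : Fin 3 => 1) v d g) →
          (∀ v : Fin 3 → k, CobordantChart.initEval (fun _ : Fin 3 => 1) (v + c₂) d g =
            CobordantChart.initEval (fun _ : Fin 3 => 1) v d g) →
          ∃ α β : k, (α ≠ 0 ∨ β ≠ 0) ∧ α • c₁ + β • c₂ = 0) →
        CobordantGame.Won k 3 g) →
      ∃ (S : Type) (germ : S → Fin d → MvPowerSeries (Fin 2) k) (μ : S → Ordinal.{0}),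
        (∀ A : Fin d → MvPowerSeries (Fin 2) k, (∀ j : Fin d, ((d - (j : ℕ) : ℕ) : ℕ∞) < (A j).order) →
          ∃ s, germ s = A) ∧
        (∀ s : S, (∀ j : Fin d, ((d - (j : ℕ) : ℕ) : ℕ∞) < (germ s j).order) →
          ∃ (θ : Fin 2 → MvPowerSeries (Fin 2) k) (φ : MvPowerSeries (Fin 2) k),
            (∀ i, constantCoeff (θ i) = 0) ∧ IsUnit (FormalCoordChange.linMat θ).det ∧ constantCoeff φ = 0 ∧
            (∀ j : Fin d, ((d - (j : ℕ) : ℕ) : ℕ∞) < (shift d (fun j => subst θ (germ s j)) φ j).order) ∧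
            ((Term k d (shift d (fun j => subst θ (germ s j)) φ) ∨
              ((∃ e : ℕ, d = p ^ e) ∧ ∀ j : Fin d, (j : ℕ) ≠ 0 → shift d (fun j => subst θ (germ s j)) φ j = 0) ∨
              (∃ (r : ℕ) (Q : Fin r → MvPowerSeries (Fin (2 + 1)) k) (mQ : Fin r → ℕ) (U : MvPowerSeries (Fin (2 + 1)) k),
                (∀ i, 1 ≤ mQ i) ∧ constantCoeff U ≠ 0 ∧
                ((X (Fin.last 2) : MvPowerSeries (Fin (2 + 1)) k) ^ d +
                  ∑ j : Fin d, rename (Fin.succAboveEmb (Fin.last 2)) (shift d (fun j => subst θ (germ s j)) φ j) *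
                    X (Fin.last 2) ^ (j : ℕ) = U * ∏ i, Q i ^ mQ i) ∧
                (∏ i, Q i).order < d)) ∨
              (∀ j : Fin d, shift d (fun j => subst θ (germ s j)) φ j = 0) ∨
              ∀ (c : Fin 2 → k), (∃ i, c i ≠ 0) →
                (c 0 ≠ 0 ∧ ∀ T' : Fin d → MvPowerSeries (Fin 2) k,
                  (∀ j : Fin d, X 0 ^ (d - (j : ℕ)) * T' j =
                    subst (PlaneGerm.dirChart (c 1 / c 0)) (shift d (fun j => subst θ (germ s j)) φ j)) →
                  ∀ φ' : MvPowerSeries (Fin 2) k, constantCoeff φ' = 0 →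
                  (∀ j : Fin d, ((d - (j : ℕ) : ℕ) : ℕ∞) < (shift d T' φ' j).order) →
                  ∃ s' : S, germ s' = shift d T' φ' ∧ μ s' < μ s) ∨
                (c 1 ≠ 0 ∧ ∀ T' : Fin d → MvPowerSeries (Fin 2) k,
                  (∀ j : Fin d, X 0 ^ (d - (j : ℕ)) * T' j =
                    subst (PlaneGerm.dirChart (c 0 / c 1))
                      (rename (Equiv.swap (0 : Fin 2) 1) (shift d (fun j => subst θ (germ s j)) φ j))) →
                  ∀ φ' : MvPowerSeries (Fin 2) k, constantCoeff φ' = 0 →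
                  (∀ j : Fin d, ((d - (j : ℕ) : ℕ) : ℕ∞) < (shift d T' φ' j).order) →
                  ∃ s' : S, germ s' = shift d T' φ' ∧ μ s' < μ s)))) :
    ∀ (p : ℕ), p.Prime → ∀ (k : Type) [Field k] [CharP k p] [IsAlgClosed k],
      (∀ m : ℕ, m < 3 → ∀ g : MvPowerSeries (Fin m) k,
        CobordantGame.IsSingular k g → CobordantGame.Won k m g) →
      ∀ (d : ℕ), p ∣ d → 2 < d →
      (∀ g : MvPowerSeries (Fin 3) k, CobordantGame.IsSingular k g → g.order < d →
        CobordantGame.Won k 3 g) →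
      (∀ g : MvPowerSeries (Fin 3) k, CobordantGame.IsSingular k g → g.order = d →
        (∃ c : Fin 3 → k, c ≠ 0 ∧ ∀ v : Fin 3 → k,
          CobordantChart.initEval (fun _ : Fin 3 => 1) (v + c) d g =
            CobordantChart.initEval (fun _ : Fin 3 => 1) v d g) →
        (∀ c₁ c₂ : Fin 3 → k,
          (∀ v : Fin 3 → k, CobordantChart.initEval (fun _ : Fin 3 => 1) (v + c₁) d g =
            CobordantChart.initEval (fun _ : Fin 3 => 1) v d g) →
          (∀ v : Fin 3 → k, CobordantChart.initEval (fun _ : Fin 3 => 1) (v + c₂) d g =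
            CobordantChart.initEval (fun _ : Fin 3 => 1) v d g) →
          ∃ α β : k, (α ≠ 0 ∨ β ≠ 0) ∧ α • c₁ + β • c₂ = 0) →
        CobordantGame.Won k 3 g) →
      ((∃ e : ℕ, d = p ^ e) → ∀ (A₀ : MvPowerSeries (Fin 2) k), (d : ℕ∞) < A₀.order →
        CobordantGame.Won k 3 (MvPowerSeries.X (Fin.last 2) ^ d +
          MvPowerSeries.rename (Fin.succAboveEmb (Fin.last 2)) A₀)) →
      ∀ A : Fin d → MvPowerSeries (Fin 2) k, (∀ j : Fin d, ((d - (j : ℕ) : ℕ) : ℕ∞) < (A j).order) →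
        CobordantGame.Won k 3 (MvPowerSeries.X (Fin.last 2) ^ d +
          ∑ j : Fin d, MvPowerSeries.rename (Fin.succAboveEmb (Fin.last 2)) (A j) * MvPowerSeries.X (Fin.last 2) ^ (j : ℕ)) := by
  intro p hp k _ _ _ hlow d hpd h2d hord haxis hpure A hA
  have hd : 0 < d := by omega
  obtain ⟨S, germ, μ, hcover, hstep⟩ := hdesc p hp k hlow d hpd h2d hord haxis
  obtain ⟨s, hs⟩ := hcover A hA
  rw [← hs]
  refine monic_won_of_descent₄ p hp k hd hord haxis
    (fun A => Term k d A ∨ ((∃ e : ℕ, d = p ^ e) ∧ ∀ j : Fin d, (j : ℕ) ≠ 0 → A j = 0) ∨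
      (∃ (r : ℕ) (Q : Fin r → MvPowerSeries (Fin (2 + 1)) k) (mQ : Fin r → ℕ) (U : MvPowerSeries (Fin (2 + 1)) k),
        (∀ i, 1 ≤ mQ i) ∧ constantCoeff U ≠ 0 ∧
        ((X (Fin.last 2) : MvPowerSeries (Fin (2 + 1)) k) ^ d +
          ∑ j : Fin d, rename (Fin.succAboveEmb (Fin.last 2)) (A j) * X (Fin.last 2) ^ (j : ℕ) = U * ∏ i, Q i ^ mQ i) ∧
        (∏ i, Q i).order < d)) ?_ germ μ ?_ s (by rw [hs]; exact hA)
  · -- the exits: terminal classes (S3ρT), pure `p^e`-th power forms (hypothesis of S3ρ), non-reduced forms (multiplicity lemma)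
    intro B hB hT
    rcases hT with hTB | ⟨hpe, hpureB⟩ | ⟨r, Q, mQ, U, hmQ, hU, hBeq, hordQ⟩
    · exact hterm p hp k d hpd h2d hord haxis B hB hTB
    · rw [monicForm_eq_purePower hd B hpureB]
      have h0 := hB ⟨0, hd⟩
      rw [Nat.sub_zero] at h0
      exact hpure hpe (B ⟨0, hd⟩) h0
    · rw [hBeq]
      have hred : CobordantGame.Won k (2 + 1) (∏ i, Q i) := by
        by_cases hQs : CobordantGame.IsSingular k (∏ i, Q i)
        · exact hord _ hQs hordQ
        · exact (wonBy_zero_of_not_isSingular (by norm_num) hQs).won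
      exact WonMultiplicity.won_unit_mul_prod_pow hred Q mQ U hmQ hU rfl
  · intro s' hs'
    obtain ⟨θ, φ, hθ0, hθdet, hφ0, hA₁, hbr⟩ := hstep s' hs'
    refine ⟨θ, φ, hθ0, hθdet, hφ0, hA₁, ?_⟩
    rcases hbr with (hT | hP | hN) | hZ | hpt
    · exact Or.inl (Or.inl hT)
    · exact Or.inl (Or.inr (Or.inl hP))
    · exact Or.inl (Or.inr (Or.inr hN))
    · exact Or.inr (Or.inl hZ)
    · exact Or.inr (Or.inr hpt)

end WildMonic

end Summit.ResolutionOfSingularities.ResolutionOfSingularities.Theorems
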